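import Summits.QuantumFields.BalabanUV.Beta.EriceFlowEnclosureB12AsPrintedPointwiseFading
import Summits.QuantumFields.BalabanUV.Beta.EriceFlowEnclosureB12AsPrintedPointwiseUniformIff

/-!
# Beta / EriceFlowEnclosureB12AsPrintedPointwiseFadingIff — WHAT (0.31) FORCES POINTWISE, part 6c: THE HISTORY-READING IFF.  Under the printed `Definitions`, (U), (C),
# `hrg` and node U2's coupling-chart moduli with FADING MEMORY, [I] Theorem 2 WITH g-UNIFORM CONSTANTS ⟺ THE AF LETTER «∃ box with 0 < b ≤ β_{k+1} ≤ b′» — part 2's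
# `uniformTheorem2_iff_afLetters_markov` with «Markov + injective one-step maps» replaced by the moduli; and the sign-free form of prover 1's gen-33 END: g-uniform
# Theorem 2 + (U) + moduli ⟹ «g₀ = g₀(ε, g)» EXISTS AND IS UNIQUE on small boxes, with NO AF letter assumed (β-flow team, prover 2 = lower ∕ positivity side, unit
# `b2b-balaban-beta-bflow-p2`, gen 43; ROW AP-I × ROW U × node U2; parts 5∕6 `…PointwiseCover ∕ …PointwiseFading`, part 2b `…PointwiseUniformIff`, prover 1's `…HistoryUnique`)

HONEST FRAMING (page 1 of everything the β sub-cell writes): discharging `BetaPertH` makes Bałaban's UV stability UNCONDITIONAL — a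
real constructive-QFT result; it is NOT the continuum limit and NOT the Clay problem.  HONEST DEPENDENCY (cell reorg 2026-08-19,
verbatim): «continuum YM on T⁴ ⇐ BetaPertH ∧ nine spine estimates (0/9 proved); BetaPertH ⇐ (D1) ∧ (D4) ∧ CAP+tail; G-an2-4 gates
asym, D1 and NE2/3/4.»  THIS MODULE DISCHARGES NOTHING: bookkeeping from the NAMED FIELDS of `B12BetaAsPrinted` ([Balaban1987RG1] as typed: `Definitions`,
`StandingHypotheses`, the tuned-run forms of `Theorem2Statement` — Theorem 2 STATED WITHOUT PROOF, p. 259) under LETTERS that are HYPOTHESES on an abstract `Setting S`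
((U) `BetaUpperH`, (C) `BetaContH`, prover 1's binder `hrg`, node U2's `HistLipschitz` ∕ `FadingMemory` — NONE printed, [I] p. 298 states the history dependence only) and ONE
READING (`hTu`: «there exist constants β, β′» before «for a sufficiently small positive g»).  Nothing of Bałaban's objects is asserted.

WHAT THIS FILE PROVES (0 sorry, 0 def):
§1 **`uniformTheorem2_iff_afLetters_fadingMemory`** (`Definitions` + (U) + `hrg` + (C) + `HistLipschitz` with `FadingMemory` on ]0, γ_U] ⟹ (`hTu` ⟺ ∃ x₁ b b′: 0 < b ≤ b′,
   `BetaLowerH b x₁ ∧ BetaUpperH b′ x₁`); (⟹) part 6's END at a small δ, (⟸) part 2b's `uniformTheorem2_of_letters` = prover 1's forward shooting),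
   **`uniformTheorem2_iff_afLetters_fadingMemory'`** (`StandingHypotheses` form: `hrg` discharged from (U) with b′γ_U² < 1 by `…TunedUpper.hrg_of_betaUpperH`).
§2 **`betaAFH_of_uniformTheorem2_fadingMemory'`** (the END of part 6 with `hrg` discharged: `StandingHypotheses` + `Definitions` + `hTu` + (U) with b′γ_U² < 1 + moduli ⟹ `BetaAFH`),
   **`theorem2_existsUnique_of_uniformTheorem2_fadingMemory`** (prover 1's `theorem2_existsUnique_of_fadingMemory` WITHOUT the AF letter and without explicit smallness: `hTu` +
   `Definitions` + (U) with b′γ_U² < 1 + moduli ⟹ for every m, small γ, small g, EVERY K: ∃! bare coupling with an in-]0, γ]-interval run ending at g).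
NOT CLAIMED: any modulus, sign or bound for Bałaban's β; Theorem 2; `BetaPertH`; continuum; Clay.
-/

namespace Summit.QuantumFields.BalabanUV.Beta.EriceFlowEnclosureB12AsPrintedPointwiseFadingIff

open Literature.MathematicalPhysics.QuantumFieldTheory.Balaban1983to89
open Literature.MathematicalPhysics.QuantumFieldTheory.Balaban1983to89.B12BetaAsPrinted
open Literature.MathematicalPhysics.QuantumFieldTheory.Balaban1983to89.FlowStep (prefixOf Box mem_box box_mono BetaContH BetaLowerH BetaUpperH
  BetaSignH BetaAFH RGEqH)
open Literature.MathematicalPhysics.QuantumFieldTheory.Balaban1983to89.T4CouplingMatching (HistLipschitz FadingMemory)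
open Summit.QuantumFields.BalabanUV.Beta.EriceFlowEnclosureB12AsPrintedTunedUpper (hrg_of_betaUpperH)
open Summit.QuantumFields.BalabanUV.Beta.EriceFlowEnclosureB12AsPrintedPointwiseUniformIff (uniformTheorem2_of_letters)
open Summit.QuantumFields.BalabanUV.Beta.EriceFlowEnclosureB12AsPrintedPointwiseFading (letters_of_uniformTheorem2_fadingMemory
  betaAFH_of_uniformTheorem2_fadingMemory exists_localUnique_of_fadingMemory)

noncomputable section

variable {S : Setting}

/-! ## §1 g-uniform Theorem 2 ⟺ the AF letter, in the history reading with fading memory -/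

/-- **[I] THEOREM 2 WITH g-UNIFORM CONSTANTS ⟺ THE AF LETTER, HISTORY READING.**  Under the printed `Definitions`, an upper bound (U), prover 1's binder `hrg`, joint continuity (C)
and node U2's coupling-chart moduli `HistLipschitz Λ γ_U S.β` with `FadingMemory C θ Λ` on ]0, γ_U]: `hTu` (Theorem 2 on the carrier with «there exist constants β, β′» before «for a
sufficiently small positive g») holds IFF some box ]0, x₁]^{k+1} (all k) carries `0 < b ≤ β_{k+1} ≤ b′`.  (⟹) part 6's END (local uniqueness and the oscillation letter from the moduli,
coverage from Theorem 2 at K = k and one more step) at δ = min(x₁, β ln L·(1 − θ)∕(2(C + 1))); (⟸) prover 1's forward shooting (`uniformTheorem2_of_letters`; (C) is used only here).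
Part 2b's `uniformTheorem2_iff_afLetters_markov` is the case of a Markov family with injective one-step maps. [cite: Balaban1987RG1, Thm 2 (0.31) p.259 with (0.18)–(0.20) pp.255–256 and p.298] -/
theorem uniformTheorem2_iff_afLetters_fadingMemory (hD : Definitions S) (hL : Odd S.L ∧ 1 < S.L) {γU M θ C : ℝ} {Λ : ℕ → ℕ → ℝ}
    (hγU : 0 < γU) (hθ0 : 0 < θ) (hθ1 : θ < 1) (hC : 0 ≤ C)
    (hrg : ∀ P : B12.RunParams, Step.InInterval γU P.K (S.cpl P) → RGEqH P.K S.β (S.cpl P))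
    (hub : BetaUpperH M γU S.β) (hHL : HistLipschitz Λ γU S.β) (hΛ : FadingMemory C θ Λ) (hcont : BetaContH γU S.β) :
    (∀ m : ℕ, ∃ γ₀ : ℝ, 0 < γ₀ ∧ ∀ γ : ℝ, 0 < γ → γ ≤ γ₀ → ∃ g₁ : ℝ, 0 < g₁ ∧ ∃ β β' : ℝ, 0 < β ∧ β ≤ β' ∧
      ∀ g : ℝ, 0 < g → g ≤ g₁ → ∀ K : ℕ, ∃ g₀ : ℝ, Step.InInterval γ K (S.cpl ⟨K, m, g₀⟩) ∧ S.cpl ⟨K, m, g₀⟩ K = g ∧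
        Step.Discrete031 (β * Real.log S.L) (β' * Real.log S.L) K g (S.cpl ⟨K, m, g₀⟩)) ↔
      ∃ x₁ b b' : ℝ, 0 < x₁ ∧ x₁ ≤ γU ∧ 0 < b ∧ b ≤ b' ∧ BetaLowerH b x₁ S.β ∧ BetaUpperH b' x₁ S.β := by
  have hlog : 0 < Real.log (S.L : ℝ) := Real.log_pos (by exact_mod_cast hL.2)
  have h1θ : 0 < 1 - θ := by linarith
  constructor
  · intro hTu
    obtain ⟨x₁, β, β', hx₁, hx₁U, hβ, hββ', h⟩ :=
      letters_of_uniformTheorem2_fadingMemory hD hTu 0 hL.2 hγU hθ0 hθ1 hC hrg hub hHL hΛ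
    have hb : 0 < β * Real.log S.L := mul_pos hβ hlog
    set δ : ℝ := min x₁ (β * Real.log S.L * (1 - θ) / (2 * (C + 1))) with hδ
    have hδpos : 0 < δ := lt_min hx₁ (by positivity)
    have hδx : δ ≤ x₁ := min_le_left _ _
    obtain ⟨hlo, hhi⟩ := h δ hδpos hδx
    have hCδ : C / (1 - θ) * δ < β * Real.log S.L := by
      have h1 : C / (1 - θ) * δ ≤ C / (1 - θ) * (β * Real.log S.L * (1 - θ) / (2 * (C + 1))) :=
        mul_le_mul_of_nonneg_left (min_le_right _ _) (div_nonneg hC h1θ.le)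
      have h2 : C / (1 - θ) * (β * Real.log S.L * (1 - θ) / (2 * (C + 1))) = β * Real.log S.L * (C / (2 * (C + 1))) := by
        field_simp
      have h3 : C / (2 * (C + 1)) < 1 := by rw [div_lt_one (by positivity)]; linarith
      have h4 : β * Real.log S.L * (C / (2 * (C + 1))) < β * Real.log S.L * 1 := mul_lt_mul_of_pos_left h3 hb
      linarith
    have hCδ0 : 0 ≤ C / (1 - θ) * δ := mul_nonneg (div_nonneg hC h1θ.le) hδpos.le
    refine ⟨δ, β * Real.log S.L - C / (1 - θ) * δ, β' * Real.log S.L + C / (1 - θ) * δ, hδpos, hδx.trans hx₁U, by linarith, ?_, hlo, hhi⟩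
    nlinarith [mul_le_mul_of_nonneg_right hββ' hlog.le]
  · rintro ⟨x₁, b, b', hx₁, hx₁U, hb, hbb', hlo, hhi⟩
    exact (uniformTheorem2_of_letters hD hL hx₁ hb hbb' (fun k => (hcont k).mono (box_mono hx₁U k)) hlo hhi).1

/-- **… `StandingHypotheses` FORM, `hrg` DISCHARGED FROM (U)**: with p. 251's ∕ Theorem 3's standing hypotheses (for 1 < L), the printed `Definitions`, (U) `BetaUpperH b′ γ_U` with b′γ_U² < 1
(whence `hrg` by `…TunedUpper.hrg_of_betaUpperH`), (C) on ]0, γ_U], and the moduli: `hTu ⟺ ∃ box with 0 < b ≤ β_{k+1} ≤ b″`.  Compare part 2b's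
`uniformTheorem2_iff_afLetters_lastVarLipschitz` (Markov + `LastVarLipschitz` with Cγ_U³ < 2). [cite: Balaban1987RG1, Thm 2 (0.31) p.259 with (0.20) p.256, Thm 3 p.264 and p.298] -/
theorem uniformTheorem2_iff_afLetters_fadingMemory' (hH : StandingHypotheses S) (hD : Definitions S) {γU b' θ C : ℝ} {Λ : ℕ → ℕ → ℝ}
    (hγU : 0 < γU) (hθ0 : 0 < θ) (hθ1 : θ < 1) (hC : 0 ≤ C) (hub : BetaUpperH b' γU S.β) (hsmall : b' * γU ^ 2 < 1)
    (hHL : HistLipschitz Λ γU S.β) (hΛ : FadingMemory C θ Λ) (hcont : BetaContH γU S.β) :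
    (∀ m : ℕ, ∃ γ₀ : ℝ, 0 < γ₀ ∧ ∀ γ : ℝ, 0 < γ → γ ≤ γ₀ → ∃ g₁ : ℝ, 0 < g₁ ∧ ∃ β β'' : ℝ, 0 < β ∧ β ≤ β'' ∧
      ∀ g : ℝ, 0 < g → g ≤ g₁ → ∀ K : ℕ, ∃ g₀ : ℝ, Step.InInterval γ K (S.cpl ⟨K, m, g₀⟩) ∧ S.cpl ⟨K, m, g₀⟩ K = g ∧
        Step.Discrete031 (β * Real.log S.L) (β'' * Real.log S.L) K g (S.cpl ⟨K, m, g₀⟩)) ↔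
      ∃ x₁ b b'' : ℝ, 0 < x₁ ∧ x₁ ≤ γU ∧ 0 < b ∧ b ≤ b'' ∧ BetaLowerH b x₁ S.β ∧ BetaUpperH b'' x₁ S.β :=
  uniformTheorem2_iff_afLetters_fadingMemory hD (hL_of_standing hH) hγU hθ0 hθ1 hC (hrg_of_betaUpperH hD hγU hub hsmall) hub hHL hΛ hcont

/-! ## §2 The END with `hrg` discharged; «g₀ = g₀(ε, g)» exists and is unique, sign-free -/

/-- **THE AF LETTER FROM THE g-UNIFORM THEOREM 2 — INPUT LIST: standing hypotheses, printed `Definitions`, (U) with b′γ_U² < 1, node U2's moduli.**  Part 6's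
`betaAFH_of_uniformTheorem2_fadingMemory` with prover 1's binder `hrg` discharged from (U) (`hrg_of_betaUpperH`): `BetaAFH S.β`.  No continuity, no Markov letter, no injectivity, no
uniqueness, no sign among the hypotheses. [cite: Balaban1987RG1, Thm 2 (0.31) p.259 with (0.20) p.256, Thm 3 p.264 and p.298] -/
theorem betaAFH_of_uniformTheorem2_fadingMemory' (hH : StandingHypotheses S) (hD : Definitions S)
    (hTu : ∀ m : ℕ, ∃ γ₀ : ℝ, 0 < γ₀ ∧ ∀ γ : ℝ, 0 < γ → γ ≤ γ₀ → ∃ g₁ : ℝ, 0 < g₁ ∧ ∃ β β' : ℝ, 0 < β ∧ β ≤ β' ∧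
      ∀ g : ℝ, 0 < g → g ≤ g₁ → ∀ K : ℕ, ∃ g₀ : ℝ, Step.InInterval γ K (S.cpl ⟨K, m, g₀⟩) ∧ S.cpl ⟨K, m, g₀⟩ K = g ∧
        Step.Discrete031 (β * Real.log S.L) (β' * Real.log S.L) K g (S.cpl ⟨K, m, g₀⟩))
    {γU b' θ C : ℝ} {Λ : ℕ → ℕ → ℝ} (hγU : 0 < γU) (hθ0 : 0 < θ) (hθ1 : θ < 1) (hC : 0 ≤ C)
    (hub : BetaUpperH b' γU S.β) (hsmall : b' * γU ^ 2 < 1) (hHL : HistLipschitz Λ γU S.β) (hΛ : FadingMemory C θ Λ) : BetaAFH S.β :=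
  betaAFH_of_uniformTheorem2_fadingMemory hD hTu 0 (hL_of_standing hH).2 hγU hθ0 hθ1 hC (hrg_of_betaUpperH hD hγU hub hsmall) hub hHL hΛ

/-- **«g₀ = g₀(ε, g)» EXISTS AND IS UNIQUE, SIGN-FREE** — prover 1's gen-33 END `theorem2_existsUnique_of_fadingMemory` WITHOUT its AF letter `BetaLowerH b` and without explicit box
smallness: `hTu` + the printed `Definitions` + (U) `BetaUpperH b′ γ_U` with b′γ_U² < 1 + `HistLipschitz Λ γ_U S.β` with `FadingMemory C θ Λ` ⟹ for every m there is γ₂ > 0 such that for every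
γ ∈ ]0, γ₂] there is g₁ > 0 with: for every g ∈ ]0, g₁] and EVERY K, EXACTLY ONE bare coupling g₀ has its run (K, m, g₀) inside ]0, γ] with g_K = g.  Existence is Theorem 2's; uniqueness is
part 6's `exists_localUnique_of_fadingMemory` (the comparison run is AF at half rate by Theorem 2's own (0.31), so prover 1's contraction closes).
[cite: Balaban1987RG1, Thm 2 (0.31) p.259 («g₀ = g₀(ε, g)») with (0.20) p.256 and p.298] -/
theorem theorem2_existsUnique_of_uniformTheorem2_fadingMemory (hD : Definitions S) (hL1 : 1 < S.L)
    (hTu : ∀ m : ℕ, ∃ γ₀ : ℝ, 0 < γ₀ ∧ ∀ γ : ℝ, 0 < γ → γ ≤ γ₀ → ∃ g₁ : ℝ, 0 < g₁ ∧ ∃ β β' : ℝ, 0 < β ∧ β ≤ β' ∧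
      ∀ g : ℝ, 0 < g → g ≤ g₁ → ∀ K : ℕ, ∃ g₀ : ℝ, Step.InInterval γ K (S.cpl ⟨K, m, g₀⟩) ∧ S.cpl ⟨K, m, g₀⟩ K = g ∧
        Step.Discrete031 (β * Real.log S.L) (β' * Real.log S.L) K g (S.cpl ⟨K, m, g₀⟩))
    {γU b' θ C : ℝ} {Λ : ℕ → ℕ → ℝ} (hγU : 0 < γU) (hθ0 : 0 < θ) (hθ1 : θ < 1) (hC : 0 ≤ C)
    (hub : BetaUpperH b' γU S.β) (hsmall : b' * γU ^ 2 < 1) (hHL : HistLipschitz Λ γU S.β) (hΛ : FadingMemory C θ Λ) (m : ℕ) :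
    ∃ γ₂ : ℝ, 0 < γ₂ ∧ ∀ γ : ℝ, 0 < γ → γ ≤ γ₂ → ∃ g₁ : ℝ, 0 < g₁ ∧ ∀ g : ℝ, 0 < g → g ≤ g₁ → ∀ K : ℕ,
      ∃! g₀ : ℝ, Step.InInterval γ K (S.cpl ⟨K, m, g₀⟩) ∧ S.cpl ⟨K, m, g₀⟩ K = g := by
  have hlog : 0 < Real.log (S.L : ℝ) := Real.log_pos (by exact_mod_cast hL1)
  have hrg := hrg_of_betaUpperH hD hγU hub hsmall
  obtain ⟨γ₀, hγ₀, hγ⟩ := hTu m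
  -- local uniqueness from Theorem 2's data at the interval min γU γ₀
  obtain ⟨g₁', hg₁', β₁, β₁', hβ₁, -, hg'⟩ := hγ (min γU γ₀) (lt_min hγU hγ₀) (min_le_right _ _)
  obtain ⟨g₂, hg₂, huniq⟩ := exists_localUnique_of_fadingMemory hD hθ0 hθ1 hC (mul_pos hβ₁ hlog) hγU hg₁' hrg hHL hΛ hg'
  refine ⟨min γ₀ g₂, lt_min hγ₀ hg₂, fun γ hγpos hγle => ?_⟩
  obtain ⟨g₁, hg₁, β, β', -, -, hg⟩ := hγ γ hγpos (hγle.trans (min_le_left _ _))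
  refine ⟨g₁, hg₁, fun g hgpos hgle K => ?_⟩
  obtain ⟨g₀, hI, hend, -⟩ := hg g hgpos hgle K
  refine ⟨g₀, ⟨hI, hend⟩, fun y hy => ?_⟩
  have hγg₂ : γ ≤ g₂ := hγle.trans (min_le_right _ _)
  exact huniq K y g₀ (fun i hi => ⟨(hy.1 i hi).1, (hy.1 i hi).2.trans hγg₂⟩)
    (fun i hi => ⟨(hI i hi).1, (hI i hi).2.trans hγg₂⟩) (hy.2.trans hend.symm)

end

end Summit.QuantumFields.BalabanUV.Beta.EriceFlowEnclosureB12AsPrintedPointwiseFadingIff
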